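import Mathlib
import HarnessLib
import Literature.Computability.AlgebraicComplexity.PatternExpressions
import Literature.Combinatorics.SimpleGraph.TreeDecomposition
import Summits.ValiantsHypothesis.ValiantsHypothesis.Theorems.MonotoneRestorationMonotoneRestorationQPLinearWidthCaterpillarHom

/-!
# Route MonotoneRestoration, crux `MonotoneRestorationQP` (stmt-15886), line `linear-width` —
# FOREST PATTERNS ARE BLIND TO ROW/COLUMN-EQUIDISTRIBUTED MATRICES (1-WL blindness in hom currency),
# with an explicit non-isomorphic pair at level `n = 4`

Helper file (`--supports stmt-ValiantsHypothesis-15886`), def-free.  Near the BOTTOM of the width scale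
`k ↦ HomIndist n k` of line `linear-width`: the homomorphism polynomials of ACYCLIC bipartite multigraph
patterns (forests with multiplicities — the treewidth-`≤ 1` patterns) do not separate `Sym_n × Sym_n`-orbits.
Precisely:

* `exists_leaf_of_isAcyclic` — a finite acyclic graph with an edge has a leaf (a vertex with exactly
  one neighbour; via the tree `ConnectedComponent.toSimpleGraph` and
  `IsTree.exists_vert_degree_one_of_nontrivial`);
* `leaf_step_row`, `leaf_step_col` — STRIPPING A LEAF: if all pattern edges at the row vertex `u` go to
  the column vertex `v` (`m` of them) and the `m`-th power sums of all COLUMNS of `X ∈ ℂ^{n×n}` equal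
  `κ`, then `n · hom_{E,n}(X) = κ · hom_{E−u,n}(X)` (`E − u` = the pattern with the edges at `u`
  deleted, `u` kept as an isolated vertex); dually for column leaves and ROW power sums;
* `eval_homPoly_eq_of_isAcyclic` — hence two matrices `A, B` whose rows all have the same power sums
  (`Σ_j A_{ij}^m = Σ_j B_{i'j}^m` for all `m, i, i'`) and whose columns all have the same power sums
  agree on `hom_{E,n}` for EVERY pattern `E` with acyclic pattern graph (induction on `|E|`);
* `exists_nonisomorphic_forestBlind_pair` — the biadjacency matrices of the `8`-cycle and of two
  disjoint `4`-cycles (`n = 4`; every row and column has two `1`s) agree on all acyclic-pattern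
  homomorphism polynomials but lie in different `Sym_4 × Sym_4`-orbits (the second has a `2 × 2`
  all-ones rectangle, the first has none).

So "determined below treewidth `2`" is a GENUINE restriction on matrix-symmetric polynomials (e.g. the
`4`-cycle polynomial `hom_{C_4,4}` separates the pair), complementing the top of the scale
(`OrbitSeparation`: from `k = 4·(n!)²` on the scale is isomorphism) and its bottom (`DeterminedVsNarrow`:
`k = 1` is trivial).  Link to `HomIndist n 2` verbatim needs `treewidth < 2 ⇒ acyclic` for pattern
graphs (cycles have brambles of order `3`), not proved here; the statements below are in terms of
`SimpleGraph.IsAcyclic` of the pattern graph.  Honest label: classical calibration (colour refinement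
does not separate equidistributed weighted bipartite graphs); no stub closed; VP ≠ VNP not moved.
[cite: DwivediPagoSeppelt2026, Def. 3.2]
-/

-- `Summit.ValiantsHypothesis.ValiantsHypothesis.…` is the tree's mandated namespace (Sub = Summit).
set_option linter.dupNamespace false

noncomputable section

namespace Summit.ValiantsHypothesis.ValiantsHypothesis.Theorems

namespace ForestBlind

open Literature.Computability.AlgebraicComplexity MvPolynomial SimpleGraph

variable {n : ℕ}

/-! ### A leaf of a finite acyclic graph -/

/-- **A finite acyclic graph with an edge has a leaf**: a vertex `w` with exactly one neighbour.
[folklore] -/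
theorem exists_leaf_of_isAcyclic {V : Type*} [Fintype V] [DecidableEq V] {G : SimpleGraph V}
    [DecidableRel G.Adj] (hG : G.IsAcyclic) {x y : V} (hxy : G.Adj x y) :
    ∃ w z : V, G.Adj w z ∧ ∀ z', G.Adj w z' → z' = z := by
  classical
  set c : G.ConnectedComponent := G.connectedComponentMk x with hc
  have hT : c.toSimpleGraph.IsTree := hG.isTree_connectedComponent c
  have hx : x ∈ c.supp := by rw [ConnectedComponent.mem_supp_iff]
  have hy : y ∈ c.supp := by
    rw [ConnectedComponent.mem_supp_iff, hc]
    exact ConnectedComponent.eq.2 hxy.symm.reachable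
  haveI : Nontrivial c.supp := ⟨⟨⟨x, hx⟩, ⟨y, hy⟩, fun h => hxy.ne (congrArg Subtype.val h)⟩⟩
  obtain ⟨w, hw⟩ := hT.exists_vert_degree_one_of_nontrivial
  rw [degree_eq_one_iff_existsUnique_adj] at hw
  obtain ⟨z, hwz, huniq⟩ := hw
  refine ⟨w.1, z.1, (c.toSimpleGraph_adj w.2 z.2).1 hwz, fun z' hz' => ?_⟩
  have hz'c : z' ∈ c.supp := by
    have hw1 : (w.1 : V) ∈ c.supp := w.2
    rw [ConnectedComponent.mem_supp_iff] at hw1 ⊢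
    rw [← hw1]
    exact ConnectedComponent.eq.2 hz'.symm.reachable
  have := huniq ⟨z', hz'c⟩ ((c.toSimpleGraph_adj w.2 hz'c).2 hz')
  exact congrArg Subtype.val this

/-! ### Splitting a sum over vertex maps at one vertex -/

/-- Value of the split map at the split vertex. [folklore] -/
theorem funSplitAt_symm_apply_self {α β : Type*} [DecidableEq α] (u : α) (x : β)
    (r : {j // j ≠ u} → β) : (Equiv.funSplitAt u β).symm (x, r) u = x := by
  simp [Equiv.funSplitAt, Equiv.piSplitAt]

/-- Value of the split map elsewhere. [folklore] -/
theorem funSplitAt_symm_apply_ne {α β : Type*} [DecidableEq α] (u : α) (x : β)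
    (r : {j // j ≠ u} → β) {j : α} (hj : j ≠ u) :
    (Equiv.funSplitAt u β).symm (x, r) j = r ⟨j, hj⟩ := by
  simp [Equiv.funSplitAt, Equiv.piSplitAt, hj]

/-- `Σ_{h : Fin a → Fin n} F h = Σ_x Σ_r F (h with h u = x, h|_{≠u} = r)`. [folklore] -/
theorem sum_split {a : ℕ} (u : Fin a) (F : (Fin a → Fin n) → ℂ) :
    ∑ h : Fin a → Fin n, F h =
      ∑ x : Fin n, ∑ r : {j // j ≠ u} → Fin n, F ((Equiv.funSplitAt u (Fin n)).symm (x, r)) := by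
  rw [← Fintype.sum_prod_type']
  exact Fintype.sum_equiv (Equiv.funSplitAt u (Fin n)) _ _ fun h =>
    (congr_arg F ((Equiv.funSplitAt u (Fin n)).symm_apply_apply h)).symm

/-! ### Stripping a leaf -/

/-- **Row-leaf step.**  If every edge of `E` at the row vertex `u` ends at the column vertex `v`, and the
`m`-th power sums of all columns of `X` equal `κ` (`m` = number of edges at `u`), then
`n · hom_{E,n}(X) = κ · hom_{E',n}(X)` with `E'` the edges of `E` not at `u`. [folklore] -/
theorem leaf_step_row {a b : ℕ} (E : Multiset (Fin a × Fin b)) (u : Fin a) (v : Fin b)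
    (hu : ∀ e ∈ E, e.1 = u → e.2 = v) (X : Fin n × Fin n → ℂ) (κ : ℂ)
    (hκ : ∀ j : Fin n, ∑ i : Fin n, X (i, j) ^ Multiset.card (E.filter fun e => e.1 = u) = κ) :
    (n : ℂ) * eval X (homPoly E n ℂ) = κ * eval X (homPoly (E.filter fun e => e.1 ≠ u) n ℂ) := by
  classical
  set m := Multiset.card (E.filter fun e => e.1 = u) with hm
  set E' := E.filter fun e => e.1 ≠ u with hE'
  rw [CaterpillarHom.eval_homPoly, CaterpillarHom.eval_homPoly]
  have hsplit : ∀ h : (Fin a → Fin n) × (Fin b → Fin n),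
      (E.map fun e => X (h.1 e.1, h.2 e.2)).prod =
        X (h.1 u, h.2 v) ^ m * (E'.map fun e => X (h.1 e.1, h.2 e.2)).prod := by
    intro h
    conv_lhs => rw [← Multiset.filter_add_not (fun e : Fin a × Fin b => e.1 = u) E]
    rw [Multiset.map_add, Multiset.prod_add]
    congr 1
    rw [Multiset.map_congr rfl (fun e he => ?_), Multiset.map_const', Multiset.prod_replicate]
    obtain ⟨heE, he1⟩ := Multiset.mem_filter.1 he
    rw [show e = (u, v) from Prod.ext he1 (hu e heE he1)]
  simp_rw [hsplit]
  let Q : ({j // j ≠ u} → Fin n) → (Fin b → Fin n) → ℂ := fun r h₂ =>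
    (E'.map fun e => if hj : e.1 = u then (1 : ℂ) else X (r ⟨e.1, hj⟩, h₂ e.2)).prod
  have hQ : ∀ (x : Fin n) (r : {j // j ≠ u} → Fin n) (h₂ : Fin b → Fin n),
      (E'.map fun e => X (((Equiv.funSplitAt u (Fin n)).symm (x, r)) e.1, h₂ e.2)).prod = Q r h₂ := by
    intro x r h₂
    refine congr_arg _ (Multiset.map_congr rfl fun e he => ?_)
    have hj : e.1 ≠ u := (Multiset.mem_filter.1 he).2
    rw [dif_neg hj, funSplitAt_symm_apply_ne u x r hj]
  rw [Fintype.sum_prod_type, Fintype.sum_prod_type, Finset.sum_comm, Finset.mul_sum,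
    Finset.sum_comm (f := fun (x : Fin a → Fin n) (y : Fin b → Fin n) =>
      (E'.map fun e => X (x e.1, y e.2)).prod), Finset.mul_sum]
  refine Finset.sum_congr rfl fun h₂ _ => ?_
  rw [sum_split u, sum_split u]
  simp_rw [hQ, funSplitAt_symm_apply_self]
  simp_rw [← Finset.mul_sum]
  rw [← Finset.sum_mul, hκ (h₂ v), Finset.sum_const, Finset.card_univ, Fintype.card_fin,
    nsmul_eq_mul]
  ring

/-- **Column-leaf step** (dual of `leaf_step_row`: ROW power sums). [folklore] -/
theorem leaf_step_col {a b : ℕ} (E : Multiset (Fin a × Fin b)) (u : Fin a) (v : Fin b)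
    (hv : ∀ e ∈ E, e.2 = v → e.1 = u) (X : Fin n × Fin n → ℂ) (κ : ℂ)
    (hκ : ∀ i : Fin n, ∑ j : Fin n, X (i, j) ^ Multiset.card (E.filter fun e => e.2 = v) = κ) :
    (n : ℂ) * eval X (homPoly E n ℂ) = κ * eval X (homPoly (E.filter fun e => e.2 ≠ v) n ℂ) := by
  classical
  set m := Multiset.card (E.filter fun e => e.2 = v) with hm
  set E' := E.filter fun e => e.2 ≠ v with hE'
  rw [CaterpillarHom.eval_homPoly, CaterpillarHom.eval_homPoly]
  have hsplit : ∀ h : (Fin a → Fin n) × (Fin b → Fin n),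
      (E.map fun e => X (h.1 e.1, h.2 e.2)).prod =
        X (h.1 u, h.2 v) ^ m * (E'.map fun e => X (h.1 e.1, h.2 e.2)).prod := by
    intro h
    conv_lhs => rw [← Multiset.filter_add_not (fun e : Fin a × Fin b => e.2 = v) E]
    rw [Multiset.map_add, Multiset.prod_add]
    congr 1
    rw [Multiset.map_congr rfl (fun e he => ?_), Multiset.map_const', Multiset.prod_replicate]
    obtain ⟨heE, he2⟩ := Multiset.mem_filter.1 he
    rw [show e = (u, v) from Prod.ext (hv e heE he2) he2]
  simp_rw [hsplit]
  let Q : (Fin a → Fin n) → ({j // j ≠ v} → Fin n) → ℂ := fun h₁ r =>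
    (E'.map fun e => if hj : e.2 = v then (1 : ℂ) else X (h₁ e.1, r ⟨e.2, hj⟩)).prod
  have hQ : ∀ (h₁ : Fin a → Fin n) (x : Fin n) (r : {j // j ≠ v} → Fin n),
      (E'.map fun e => X (h₁ e.1, ((Equiv.funSplitAt v (Fin n)).symm (x, r)) e.2)).prod = Q h₁ r := by
    intro h₁ x r
    refine congr_arg _ (Multiset.map_congr rfl fun e he => ?_)
    have hj : e.2 ≠ v := (Multiset.mem_filter.1 he).2
    rw [dif_neg hj, funSplitAt_symm_apply_ne v x r hj]
  rw [Fintype.sum_prod_type, Fintype.sum_prod_type, Finset.mul_sum, Finset.mul_sum]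
  refine Finset.sum_congr rfl fun h₁ _ => ?_
  rw [sum_split v, sum_split v]
  simp_rw [hQ, funSplitAt_symm_apply_self]
  simp_rw [← Finset.mul_sum]
  rw [← Finset.sum_mul, hκ (h₁ u), Finset.sum_const, Finset.card_univ, Fintype.card_fin,
    nsmul_eq_mul]
  ring

/-! ### Forest patterns do not separate equidistributed matrices -/

/-- Sub-patterns have pattern subgraphs. [folklore] -/
theorem patternGraph_mono {a b : ℕ} {E₁ E : Multiset (Fin a × Fin b)} (h : E₁ ≤ E) :
    (SimpleGraph.fromRel fun x y : Fin a ⊕ Fin b => ∃ p ∈ E₁, x = Sum.inl p.1 ∧ y = Sum.inr p.2) ≤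
      SimpleGraph.fromRel fun x y : Fin a ⊕ Fin b => ∃ p ∈ E, x = Sum.inl p.1 ∧ y = Sum.inr p.2 := by
  intro x y hxy
  rw [SimpleGraph.fromRel_adj] at hxy ⊢
  refine ⟨hxy.1, hxy.2.imp ?_ ?_⟩
  · rintro ⟨p, hp, h1, h2⟩
    exact ⟨p, Multiset.mem_of_le h hp, h1, h2⟩
  · rintro ⟨p, hp, h1, h2⟩
    exact ⟨p, Multiset.mem_of_le h hp, h1, h2⟩

/-- **Forest-pattern homomorphism polynomials agree on row/column-equidistributed matrices.**  If all
rows of `A` and `B` have the same power sums and all columns of `A` and `B` have the same power sums,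
then `hom_{E,n}(A) = hom_{E,n}(B)` for every bipartite multigraph pattern `E` whose pattern graph is
acyclic. [folklore] -/
theorem eval_homPoly_eq_of_isAcyclic (A B : Fin n × Fin n → ℂ)
    (hrow : ∀ (m : ℕ) (i i' : Fin n), ∑ j, A (i, j) ^ m = ∑ j, B (i', j) ^ m)
    (hcol : ∀ (m : ℕ) (j j' : Fin n), ∑ i, A (i, j) ^ m = ∑ i, B (i, j') ^ m) :
    ∀ (a b : ℕ) (E : Multiset (Fin a × Fin b)),
      (SimpleGraph.fromRel fun x y : Fin a ⊕ Fin b =>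
        ∃ p ∈ E, x = Sum.inl p.1 ∧ y = Sum.inr p.2).IsAcyclic →
      eval A (homPoly E n ℂ) = eval B (homPoly E n ℂ) := by
  classical
  suffices H : ∀ (N a b : ℕ) (E : Multiset (Fin a × Fin b)), Multiset.card E = N →
      (SimpleGraph.fromRel fun x y : Fin a ⊕ Fin b =>
        ∃ p ∈ E, x = Sum.inl p.1 ∧ y = Sum.inr p.2).IsAcyclic →
      eval A (homPoly E n ℂ) = eval B (homPoly E n ℂ) from fun a b E hE => H _ a b E rfl hE
  intro N
  induction N using Nat.strong_induction_on with
  | _ N ih =>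
  intro a b E hN hE
  rcases Multiset.empty_or_exists_mem E with rfl | ⟨e₀, he₀⟩
  · simp [CaterpillarHom.eval_homPoly]
  rcases Nat.eq_zero_or_pos n with hn | hn
  · subst hn
    have hAB : A = B := funext fun ij => ij.1.elim0
    rw [hAB]
  have hn0 : (n : ℂ) ≠ 0 := Nat.cast_ne_zero.2 hn.ne'
  let i₀ : Fin n := ⟨0, hn⟩
  have hadj : ∀ e ∈ E, (SimpleGraph.fromRel fun x y : Fin a ⊕ Fin b =>
      ∃ p ∈ E, x = Sum.inl p.1 ∧ y = Sum.inr p.2).Adj (Sum.inl e.1) (Sum.inr e.2) := fun e he => by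
    rw [SimpleGraph.fromRel_adj]
    exact ⟨Sum.inl_ne_inr, Or.inl ⟨e, he, rfl, rfl⟩⟩
  obtain ⟨w, z, hwz, huniq⟩ := exists_leaf_of_isAcyclic hE (hadj e₀ he₀)
  have hwz' := hwz
  rw [SimpleGraph.fromRel_adj] at hwz'
  rcases w with u | v
  · -- row leaf `u` with neighbour `inr v`
    obtain ⟨v, hzv, hex⟩ : ∃ v : Fin b, z = Sum.inr v ∧ ∃ e ∈ E, e.1 = u := by
      rcases hwz'.2 with ⟨p, hp, h1, h2⟩ | ⟨p, hp, h1, h2⟩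
      · exact ⟨p.2, h2, p, hp, (Sum.inl_injective h1).symm⟩
      · exact absurd h2 Sum.inl_ne_inr
    subst hzv
    have hu : ∀ e ∈ E, e.1 = u → e.2 = v := fun e he h1 =>
      Sum.inr_injective (huniq _ (h1 ▸ hadj e he))
    set m := Multiset.card (E.filter fun e => e.1 = u) with hm
    have hκA : ∀ j, ∑ i, A (i, j) ^ m = ∑ i, B (i, i₀) ^ m := fun j => hcol m j i₀
    have hκB : ∀ j, ∑ i, B (i, j) ^ m = ∑ i, B (i, i₀) ^ m := fun j => by
      rw [← hcol m i₀ j, hcol m i₀ i₀]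
    have hA := leaf_step_row E u v hu A _ hκA
    have hB := leaf_step_row E u v hu B _ hκB
    have hlt : Multiset.card (E.filter fun e => e.1 ≠ u) < N := by
      obtain ⟨e, he, he1⟩ := hex
      have h1 : 0 < Multiset.card (E.filter fun e => e.1 = u) :=
        Multiset.card_pos_iff_exists_mem.2 ⟨e, Multiset.mem_filter.2 ⟨he, he1⟩⟩
      have h2 : Multiset.card (E.filter fun e => e.1 = u) +
          Multiset.card (E.filter fun e => ¬ e.1 = u) = N := by
        rw [← Multiset.card_add, Multiset.filter_add_not]; exact hN
      have h3 : Multiset.card (E.filter fun e => e.1 ≠ u) =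
          Multiset.card (E.filter fun e => ¬ e.1 = u) := rfl
      omega
    have hIH := ih _ hlt a b _ rfl (hE.anti (patternGraph_mono (Multiset.filter_le _ E)))
    refine mul_left_cancel₀ hn0 ?_
    rw [hA, hIH, ← hB]
  · -- column leaf `v` with neighbour `inl u`
    obtain ⟨u, hzu, hex⟩ : ∃ u : Fin a, z = Sum.inl u ∧ ∃ e ∈ E, e.2 = v := by
      rcases hwz'.2 with ⟨p, hp, h1, h2⟩ | ⟨p, hp, h1, h2⟩
      · exact absurd h1 Sum.inr_ne_inl
      · exact ⟨p.1, h1, p, hp, (Sum.inr_injective h2).symm⟩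
    subst hzu
    have hv : ∀ e ∈ E, e.2 = v → e.1 = u := fun e he h2 =>
      Sum.inl_injective (huniq _ (h2 ▸ (hadj e he).symm))
    set m := Multiset.card (E.filter fun e => e.2 = v) with hm
    have hκA : ∀ i, ∑ j, A (i, j) ^ m = ∑ j, B (i₀, j) ^ m := fun i => hrow m i i₀
    have hκB : ∀ i, ∑ j, B (i, j) ^ m = ∑ j, B (i₀, j) ^ m := fun i => by
      rw [← hrow m i₀ i, hrow m i₀ i₀]
    have hA := leaf_step_col E u v hv A _ hκA
    have hB := leaf_step_col E u v hv B _ hκB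
    have hlt : Multiset.card (E.filter fun e => e.2 ≠ v) < N := by
      obtain ⟨e, he, he2⟩ := hex
      have h1 : 0 < Multiset.card (E.filter fun e => e.2 = v) :=
        Multiset.card_pos_iff_exists_mem.2 ⟨e, Multiset.mem_filter.2 ⟨he, he2⟩⟩
      have h2 : Multiset.card (E.filter fun e => e.2 = v) +
          Multiset.card (E.filter fun e => ¬ e.2 = v) = N := by
        rw [← Multiset.card_add, Multiset.filter_add_not]; exact hN
      have h3 : Multiset.card (E.filter fun e => e.2 ≠ v) =
          Multiset.card (E.filter fun e => ¬ e.2 = v) := rfl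
      omega
    have hIH := ih _ hlt a b _ rfl (hE.anti (patternGraph_mono (Multiset.filter_le _ E)))
    refine mul_left_cancel₀ hn0 ?_
    rw [hA, hIH, ← hB]

/-! ### An explicit non-isomorphic pair at level `4`: the `8`-cycle and two `4`-cycles -/

/-- The biadjacency table of the `8`-cycle (`row i ∼ columns i, i+1 mod 4`) has no `2 × 2` all-ones
rectangle. [folklore] -/
theorem cycle8_noRect : ∀ i i' j j' : Fin 4, i ≠ i' → j ≠ j' →
    ¬ ((![![1,1,0,0],![0,1,1,0],![0,0,1,1],![1,0,0,1]] : Fin 4 → Fin 4 → ℕ) i j = 1 ∧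
       (![![1,1,0,0],![0,1,1,0],![0,0,1,1],![1,0,0,1]] : Fin 4 → Fin 4 → ℕ) i j' = 1 ∧
       (![![1,1,0,0],![0,1,1,0],![0,0,1,1],![1,0,0,1]] : Fin 4 → Fin 4 → ℕ) i' j = 1 ∧
       (![![1,1,0,0],![0,1,1,0],![0,0,1,1],![1,0,0,1]] : Fin 4 → Fin 4 → ℕ) i' j' = 1) := by
  decide

/-- Row power sums of the `8`-cycle table: two `1`s in every row. [folklore] -/
theorem rows_cycle8 (m : ℕ) (i : Fin 4) :
    ∑ j : Fin 4, (((![![1,1,0,0],![0,1,1,0],![0,0,1,1],![1,0,0,1]] : Fin 4 → Fin 4 → ℕ) i j : ℕ) : ℂ) ^ m =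
      if m = 0 then 4 else 2 := by
  rcases Nat.eq_zero_or_pos m with rfl | hm
  · norm_num
  · rw [if_neg hm.ne']
    fin_cases i <;> simp [Fin.sum_univ_four, zero_pow hm.ne'] <;> norm_num

/-- Column power sums of the `8`-cycle table: two `1`s in every column. [folklore] -/
theorem cols_cycle8 (m : ℕ) (j : Fin 4) :
    ∑ i : Fin 4, (((![![1,1,0,0],![0,1,1,0],![0,0,1,1],![1,0,0,1]] : Fin 4 → Fin 4 → ℕ) i j : ℕ) : ℂ) ^ m =
      if m = 0 then 4 else 2 := by
  rcases Nat.eq_zero_or_pos m with rfl | hm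
  · norm_num
  · rw [if_neg hm.ne']
    fin_cases j <;> simp [Fin.sum_univ_four, zero_pow hm.ne'] <;> norm_num

/-- Row power sums of the two-`4`-cycles table (`J₂ ⊕ J₂`). [folklore] -/
theorem rows_twoSquares (m : ℕ) (i : Fin 4) :
    ∑ j : Fin 4, (((![![1,1,0,0],![1,1,0,0],![0,0,1,1],![0,0,1,1]] : Fin 4 → Fin 4 → ℕ) i j : ℕ) : ℂ) ^ m =
      if m = 0 then 4 else 2 := by
  rcases Nat.eq_zero_or_pos m with rfl | hm
  · norm_num
  · rw [if_neg hm.ne']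
    fin_cases i <;> simp [Fin.sum_univ_four, zero_pow hm.ne'] <;> norm_num

/-- Column power sums of the two-`4`-cycles table. [folklore] -/
theorem cols_twoSquares (m : ℕ) (j : Fin 4) :
    ∑ i : Fin 4, (((![![1,1,0,0],![1,1,0,0],![0,0,1,1],![0,0,1,1]] : Fin 4 → Fin 4 → ℕ) i j : ℕ) : ℂ) ^ m =
      if m = 0 then 4 else 2 := by
  rcases Nat.eq_zero_or_pos m with rfl | hm
  · norm_num
  · rw [if_neg hm.ne']
    fin_cases j <;> simp [Fin.sum_univ_four, zero_pow hm.ne'] <;> norm_num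

/-- The two tables lie in different `Sym_4 × Sym_4`-orbits (a rectangle of `J₂ ⊕ J₂` would map to a
rectangle of the `8`-cycle). [folklore] -/
theorem twoSquares_ne_perm_cycle8 (σ τ : Equiv.Perm (Fin 4)) :
    (fun ij : Fin 4 × Fin 4 => (((![![1,1,0,0],![1,1,0,0],![0,0,1,1],![0,0,1,1]] : Fin 4 → Fin 4 → ℕ) ij.1 ij.2 : ℕ) : ℂ)) ≠
      fun ij : Fin 4 × Fin 4 =>
        (fun ij : Fin 4 × Fin 4 => (((![![1,1,0,0],![0,1,1,0],![0,0,1,1],![1,0,0,1]] : Fin 4 → Fin 4 → ℕ) ij.1 ij.2 : ℕ) : ℂ)) (σ ij.1, τ ij.2) := by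
  intro h
  have key : ∀ i j : Fin 4, (![![1,1,0,0],![1,1,0,0],![0,0,1,1],![0,0,1,1]] : Fin 4 → Fin 4 → ℕ) i j = 1 → (![![1,1,0,0],![0,1,1,0],![0,0,1,1],![1,0,0,1]] : Fin 4 → Fin 4 → ℕ) (σ i) (τ j) = 1 := by
    intro i j hij
    have := congr_fun h (i, j)
    simp only at this
    exact_mod_cast (hij ▸ this).symm
  exact cycle8_noRect (σ 0) (σ 1) (τ 0) (τ 1) (σ.injective.ne (by decide)) (τ.injective.ne (by decide))
    ⟨key 0 0 (by decide), key 0 1 (by decide), key 1 0 (by decide), key 1 1 (by decide)⟩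

/-- **AN EXPLICIT FOREST-BLIND NON-ISOMORPHIC PAIR.**  At level `n = 4` the biadjacency matrices of the
`8`-cycle and of two disjoint `4`-cycles agree on the homomorphism polynomial of EVERY bipartite
multigraph pattern with acyclic pattern graph, yet are not row/column permutations of each other.
[folklore] -/
theorem exists_nonisomorphic_forestBlind_pair :
    ∃ A B : Fin 4 × Fin 4 → ℂ,
      (∀ (a b : ℕ) (E : Multiset (Fin a × Fin b)),
        (SimpleGraph.fromRel fun x y : Fin a ⊕ Fin b =>
          ∃ p ∈ E, x = Sum.inl p.1 ∧ y = Sum.inr p.2).IsAcyclic →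
        eval A (homPoly E 4 ℂ) = eval B (homPoly E 4 ℂ)) ∧
      ∀ σ τ : Equiv.Perm (Fin 4), B ≠ fun ij : Fin 4 × Fin 4 => A (σ ij.1, τ ij.2) :=
  ⟨fun ij => (((![![1,1,0,0],![0,1,1,0],![0,0,1,1],![1,0,0,1]] : Fin 4 → Fin 4 → ℕ) ij.1 ij.2 : ℕ) : ℂ), fun ij => (((![![1,1,0,0],![1,1,0,0],![0,0,1,1],![0,0,1,1]] : Fin 4 → Fin 4 → ℕ) ij.1 ij.2 : ℕ) : ℂ),
    fun a b E hE => eval_homPoly_eq_of_isAcyclic _ _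
      (fun m i i' => (rows_cycle8 m i).trans (rows_twoSquares m i').symm)
      (fun m j j' => (cols_cycle8 m j).trans (cols_twoSquares m j').symm) a b E hE,
    twoSquares_ne_perm_cycle8⟩

end ForestBlind

end Summit.ValiantsHypothesis.ValiantsHypothesis.Theorems

end
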